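import Literature.NumberTheory.Automorphic.ArchInnerFormChartMeasures          -- (T-MEAS-G′) LH3-p02: `chartTorusG ∕ chartBoxImgG ∕ chartHaarG ∕ chartOrbG`, `chartTorusG_eq_centralizer`
import Literature.NumberTheory.Automorphic.ArchInnerFormCartanAtlasRegular      -- ★ LH3-p03: `isRegularElt_gprimeTorus_iff_mem_regG`
import Literature.NumberTheory.Automorphic.ArchCartanNormalisers               -- ★ (COORD) LH3-p01: `archRG` (Shelstad's `R_T` on the `G′`-charts)
import Literature.NumberTheory.Rogawski1990.ArchSingularOrbitalIntegralDictionary -- ★ (D3) `exists_classOrbitalIntegral_mk_eq_integral_descConj_smul_of_atPoint_eq`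
import Literature.NumberTheory.Automorphic.OrbitalMeasureQuotientOfPoint        -- ★ `atPoint_eq_quotientMeasure_of_isQuotientOf_of_archCoherent` ((W′)+(C′) read at a regular point)
import Literature.NumberTheory.Automorphic.UnitaryGroupDiagTraceExplicitWeights  -- ★ `quotientMeasure_eq_inv_smul_of_eq_smul` (`dν ∕ d(κρ) = κ⁻¹ dν ∕ dρ`)
import Literature.NumberTheory.Rogawski1990.TransferFactsCanonical              -- ★ `OrbitalMeasureFamily.IsQuotientOf` ((W′) of ★ `ArchCompatibleFamiliesG`)
import HarnessLib

/-!
# The ordinary orbital family `orbFamG ν′ a′ = R′ · chartOrbG` on the `G′`-atlas, Haar-freeness of `chartOrbG`, and the (CUR-chart) junction with the frame's class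
# orbital integral (Shelstad 1979 §4 p. 22 `Ψ^T_f = R_T Φ_f`; Bouaziz 1994 §3.1 `J_G(φ)`; Rogawski 1990 §1.7, §4.3, §8.2; Deitmar–Echterhoff 2014 Thm. 1.5.3)

Topic `NumberTheory/Rogawski1990`; namespaces `Literature.MeasureTheory.Group` (§1, generic) and `Literature.NumberTheory.Rogawski1990` (§2–§3).  ONE definition WITH BODY
(`orbFamG`) + theorems; no instance, no notation, no axiom, no named fact, no `sorry`.  Cell `pub/hodgecm-mathlib`, crux H413 (`stmt-HodgeConjecture-24833`), F0∕P3c line LH3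
(closer stub `stub_N9`, DIRECT ROAD): PART 2 of organ (D2′) + the `G′` half of (CUR-chart) (LH3-plan (g2) PACK-SPEC v1 §1–§2; RULING 2026-09-02T06:04:21Z), LH3-p02 (g2).

* §1 (generic, `Literature.MeasureTheory.Group`) **`toReal_measure_mul_integral_quotientMeasure_eq_of_isHaarMeasure`** — BOX-NORMALISED QUOTIENT INTEGRALS ARE HAAR-FREE:
  for Haar `μ₁, μ₂` on a closed subgroup `T` and any `B ⊆ T`, `μ₁(B) · ∫ F d(ν ∕ μ₁) = μ₂(B) · ∫ F d(ν ∕ μ₂)` (`μ₁ = κ μ₂`, `dν ∕ d(κμ₂) = κ⁻¹ dν ∕ dμ₂`) — the mechanism of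
  PACK-SPEC (δ3), usable on both sides (`H`: LH2-p04's `chartOrbH_eq_of_isHaarMeasure`; `G′`: §3 below).
* §2 **`orbFamG L α ν′ a′ : Finset W → (W → Fin 3 → ℝ) → ℂ`**, `S′ c ↦ archRG S′ c * chartOrbG L α ν′ S′ a′ c` on ADMISSIBLE labels (`S′ ⊆ splitChartPlaces L α`), `0` on the
  others (ED. 2: zero-extension, PACK-SPEC §2) — Shelstad's `Ψ^T_f = R_T · Φ_f` on the chart `T_{S′}` of `G′_∞ = U(diag α)(L⁺ ⊗ ℝ)` (ORDINARY classes: no stable sum); binders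
  exactly those of ★ `chartOrbG` (the ruling's signature target); `orbFamG_apply` (admissible), `orbFamG_of_not` (junk), `orbFamG_zero`.
* §3 **`chartOrbG_eq_of_isHaarMeasure`** (`chartOrbG` against ANY Haar measure on `T_{S′}`) and THE JUNCTION **`classOrbitalIntegral_mul_measure_box_eq_chartOrbG`**: for a
  Weil-form frame on `G′_∞` ((W′)+(C′) of ★ `ArchCompatibleFamiliesG`, clause binders) and a regular chart point `γ′ = gprimeTorus α S′ c` (`c ∈ RegG S′`):
  `Φ(⟦γ′⟧, a′; m′) · (t′(γ′) carried to T_{S′})(B′) = chartOrbG ν′ S′ a′ c` — the frame's class orbital integral IS the chart functional up to ONE explicit scalar, the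
  `t′(γ′)`-mass of the chart box (the frame's free Haar scalar made visible).  With ★ p849637 `map_tH_eq_t'_partner` that mass is the `t_H(γ_H)`-mass of the transported
  box — the SAME for every partner of `γ_H` once the `H`- and `G′`-boxes correspond under `e ∘ ι` ((PARTNER), LH3-p03; docked in the skeleton).
NOT HERE: the `H`-side twin of the junction (over LH2-p04's B1∕B2 `chartTorusH_eq_range` ∕ `chartOrbH_eq_of_isHaarMeasure` + ★ (CENT-H)), (P)∕(W) riders of `orbFamG`
(need `archRG`∕`gprimeTorus` periodicity and swap lemmas of the atlas), the letter O-L1 «`orbFamG ν′ a′ ∈ ArchHCSpaceG s jc′`» (D2′-pack).  HONEST LABEL: HC_CM is proved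
only modulo the 7 printed citations (2 remaining: hLiu418 = `stmt-HodgeConjecture-24832`, h413 = `stmt-HodgeConjecture-24833`) until rung 0 closes; count-neutral plumbing.

## References
* [Shelstad1979] D. Shelstad, *Characters and inner forms of a quasi-split group over ℝ*, Compositio Math. 39 (1979), §4 p. 20 (compatible `dt′, dt`), p. 22 (`Ψ^T_f = R_T Φ_f`).
* [Bouaziz1994IntegralesOrbitales] A. Bouaziz, *Intégrales orbitales sur les groupes de Lie réductifs*, Ann. Sci. ÉNS 27 (1994), §3.1 p. 579 (`J_G(φ)`).
* [Rogawski1990] J. D. Rogawski, *Automorphic Representations of Unitary Groups in Three Variables*, Ann. of Math. Stud. 123 (1990), §1.7 p. 6, §4.3 (4.3.1) p. 43, §8.2 p. 122.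
* [DeitmarEchterhoff2014] A. Deitmar, S. Echterhoff, *Principles of Harmonic Analysis*, 2nd ed. (2014), Thm. 1.5.3 (quotient integral formula, uniqueness up to a scalar).
* [Folland1995] G. B. Folland, *A Course in Abstract Harmonic Analysis* (1995), §2.6 Thm. 2.49, (2.52).
-/

set_option autoImplicit false

noncomputable section

open MeasureTheory MeasureTheory.Measure NumberField NumberField.InfinitePlace Matrix Complex Topology
open Literature.MeasureTheory.Group
open scoped MatrixGroups Matrix Classical NNReal ENNReal


namespace Literature.MeasureTheory.Group

/-! ## §1 (generic) Box-normalised quotient integrals are Haar-free -/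

section HaarFree

variable {G : Type*} [Group G] [TopologicalSpace G] [IsTopologicalGroup G] [LocallyCompactSpace G] [SecondCountableTopology G] [T2Space G]
  [MeasurableSpace G] [BorelSpace G] (T : Subgroup G) (hT : IsClosed (T : Set G)) [MeasurableSpace (G ⧸ T)] [BorelSpace (G ⧸ T)]
  (ν : Measure G) [ν.IsHaarMeasure] [ν.IsMulRightInvariant]

include hT in
/-- **BOX-NORMALISED QUOTIENT INTEGRALS ARE HAAR-FREE.**  For two Haar measures `μ₁, μ₂` (inversion invariant) on the closed subgroup `T` and any set `B ⊆ T`: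
`μ₁(B) · ∫ F d(ν ∕ μ₁) = μ₂(B) · ∫ F d(ν ∕ μ₂)` — `μ₁ = κ μ₂` (Haar uniqueness, `κ = haarScalarFactor μ₁ μ₂ > 0`) multiplies the mass by `κ` and the Weil quotient measure by `κ⁻¹`
(★ `quotientMeasure_eq_inv_smul_of_eq_smul`).  The mechanism of PACK-SPEC (δ3): the prefactor `dt(B)` makes the chart orbital functionals independent of the auxiliary Haar
measure. [cite: DeitmarEchterhoff2014, Thm. 1.5.3] [cite: Folland1995, §2.6 (2.52)] -/
theorem toReal_measure_mul_integral_quotientMeasure_eq_of_isHaarMeasure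
    (μ₁ μ₂ : Measure T) [μ₁.IsHaarMeasure] [μ₁.IsInvInvariant] [μ₂.IsHaarMeasure] [μ₂.IsInvInvariant] (B : Set T) (F : G ⧸ T → ℂ) :
    ((μ₁ B).toReal : ℂ) * ∫ y, F y ∂(quotientMeasure T μ₁ hT ν) = ((μ₂ B).toReal : ℂ) * ∫ y, F y ∂(quotientMeasure T μ₂ hT ν) := by
  haveI : LocallyCompactSpace T := hT.isClosedEmbedding_subtypeVal.locallyCompactSpace
  haveI : SecondCountableTopology T := TopologicalSpace.Subtype.secondCountableTopology _
  set κ := Measure.haarScalarFactor μ₁ μ₂ with hκdef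
  have hκ : κ ≠ 0 := (Measure.haarScalarFactor_pos_of_isHaarMeasure μ₁ μ₂).ne'
  have h12 : μ₁ = κ • μ₂ := Measure.isMulLeftInvariant_eq_smul_of_regular μ₁ μ₂
  haveI := hT
  have hq : quotientMeasure T μ₁ hT ν = κ⁻¹ • quotientMeasure T μ₂ hT ν :=
    quotientMeasure_eq_inv_smul_of_eq_smul T ν μ₂ μ₁ κ hκ h12
  have hB : ((μ₁ B).toReal : ℂ) = (κ : ℂ) * ((μ₂ B).toReal : ℂ) := by
    rw [h12, Measure.smul_apply, ENNReal.toReal_smul, NNReal.smul_def, smul_eq_mul, Complex.ofReal_mul]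
  have hκC : ((κ : ℝ) : ℂ) ≠ 0 := by exact_mod_cast hκ
  rw [hq, integral_smul_nnreal_measure, hB, NNReal.smul_def, Complex.real_smul, NNReal.coe_inv, Complex.ofReal_inv]
  field_simp

end HaarFree

end Literature.MeasureTheory.Group

namespace Literature.NumberTheory.Rogawski1990

open Literature.NumberTheory.Automorphic Literature.NumberTheory.Automorphic.UnitaryGroup Literature.NumberTheory.Automorphic.ArchCartan

/-! ## §2 The ordinary orbital family `orbFamG ν′ a′` on the `G′`-atlas -/

section OrbFam

variable (L : Type) [Field L] [NumberField L] [IsCMField L] (α : Fin 3 → L)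
  [MeasurableSpace ↥(arch (↥(maximalRealSubfield L)) L (IsCMField.complexConj L) 3 (Matrix.diagonal α))] [BorelSpace ↥(arch (↥(maximalRealSubfield L)) L (IsCMField.complexConj L) 3 (Matrix.diagonal α))]
  (ν' : Measure ↥(arch (↥(maximalRealSubfield L)) L (IsCMField.complexConj L) 3 (Matrix.diagonal α))) [IsFiniteMeasureOnCompacts ν'] [ν'.IsMulRightInvariant]

/-- **`orbFamG ν′ a′` — THE `R′`-NORMALISED ORDINARY ORBITAL FAMILY OF `a′` ON THE `G′`-ATLAS** (PACK-SPEC §2): on an ADMISSIBLE chart label `S′` (every `w ∈ S′` a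
split-chart place, ★ `splitChartPlaces L α` — the places where `G′_w = U(2,1)` carries a noncompact Cartan), `c ↦ R′_{S′}(c) · chartOrbG ν′ S′ a′ c` — Shelstad's
`Ψ^T_f = R_T · Φ_f` [Shelstad1979, §4 p. 22] (★ `archRG` = `R_T`, ★ `chartOrbG` = the box-normalised Weil-form orbital integral at the chart point `gprimeTorus α S′ c`; ORDINARY
classes: no stable sum), Bouaziz's `J_G(φ)` read on the Cartan `T_{S′}` [§3.1 p. 579]; ZERO on the other («junk») labels (ED. 2: PACK-SPEC §2 «read only for `S′ ⊆ W_ind`,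
zero-extended»; on a junk label ★ `gprimeBlock` falls back to the compact chart and slot `0` would be read as an angle, making (I₄) of ★ `ArchHCSpaceG` false for the genuine
family — LH3-p02 (I₄) census 2026-09-02).  A plain function of `c`, defined for every `S′`. [cite: Shelstad1979, §4 p. 22] [cite: Bouaziz1994IntegralesOrbitales, §3.1 p. 579]
[cite: Rogawski1990, §8.2 p. 122] -/
def orbFamG (a' : ↥(arch (↥(maximalRealSubfield L)) L (IsCMField.complexConj L) 3 (Matrix.diagonal α)) → ℂ) : Finset {w : InfinitePlace L // IsComplex w} → ({w : InfinitePlace L // IsComplex w} → Fin 3 → ℝ) → ℂ :=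
  fun S' c => if ∀ w, w ∈ S' → w ∈ splitChartPlaces L α then archRG S' c * chartOrbG L α ν' S' a' c else 0

/-- `orbFamG` on an ADMISSIBLE label (every `w ∈ S′` a split-chart place): `R′ · chartOrbG`. [cite: Shelstad1979, §4 p. 22] -/
theorem orbFamG_apply (a' : ↥(arch (↥(maximalRealSubfield L)) L (IsCMField.complexConj L) 3 (Matrix.diagonal α)) → ℂ) {S' : Finset {w : InfinitePlace L // IsComplex w}} (hS' : ∀ w, w ∈ S' → w ∈ splitChartPlaces L α) (c : {w : InfinitePlace L // IsComplex w} → Fin 3 → ℝ) :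
    orbFamG L α ν' a' S' c = archRG S' c * chartOrbG L α ν' S' a' c :=
  if_pos hS'

/-- `orbFamG` VANISHES on a junk label (some `w ∈ S′` not a split-chart place). [cite: Shelstad1979, §4 p. 22] -/
theorem orbFamG_of_not (a' : ↥(arch (↥(maximalRealSubfield L)) L (IsCMField.complexConj L) 3 (Matrix.diagonal α)) → ℂ) {S' : Finset {w : InfinitePlace L // IsComplex w}} (hS' : ¬ ∀ w, w ∈ S' → w ∈ splitChartPlaces L α) :
    orbFamG L α ν' a' S' = fun _ => 0 :=
  funext fun _ => if_neg hS'

/-- `orbFamG ν′ 0 = 0`. [cite: Shelstad1979, §4 p. 22] -/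
theorem orbFamG_zero : orbFamG L α ν' (0 : ↥(arch (↥(maximalRealSubfield L)) L (IsCMField.complexConj L) 3 (Matrix.diagonal α)) → ℂ) = fun _ _ => 0 := by
  funext S' c
  by_cases hS' : ∀ w, w ∈ S' → w ∈ splitChartPlaces L α
  · rw [orbFamG_apply L α ν' 0 hS', chartOrbG_zero, mul_zero]
  · rw [orbFamG_of_not L α ν' 0 hS']

end OrbFam

/-! ## §3 Haar-freeness of `chartOrbG` and the (CUR-chart) junction with the frame's class orbital integral -/

section Junction

variable (L : Type) [Field L] [NumberField L] [IsCMField L] (α : Fin 3 → L)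
  [MeasurableSpace ↥(arch (↥(maximalRealSubfield L)) L (IsCMField.complexConj L) 3 (Matrix.diagonal α))] [BorelSpace ↥(arch (↥(maximalRealSubfield L)) L (IsCMField.complexConj L) 3 (Matrix.diagonal α))]
  (ν' : Measure ↥(arch (↥(maximalRealSubfield L)) L (IsCMField.complexConj L) 3 (Matrix.diagonal α))) [ν'.IsHaarMeasure] [ν'.IsMulRightInvariant]
  (S' : Finset {w : InfinitePlace L // IsComplex w})

/-- **`chartOrbG` IS HAAR-FREE** (PACK-SPEC (δ3) made a theorem on the `G′` side): for ANY inversion-invariant Haar measure `μ` on the chart torus `T_{S′}`,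
`chartOrbG ν′ S′ a′ c = μ(B′) · ∫ y, a′ (y · gprimeTorus α S′ c · y⁻¹) d(ν′ ∕ μ)(ȳ)`. [cite: DeitmarEchterhoff2014, Thm. 1.5.3] [cite: Folland1995, §2.6 (2.52)] -/
theorem chartOrbG_eq_of_isHaarMeasure (μ : Measure ↥(chartTorusG L α S')) [μ.IsHaarMeasure] [μ.IsInvInvariant] (a' : ↥(arch (↥(maximalRealSubfield L)) L (IsCMField.complexConj L) 3 (Matrix.diagonal α)) → ℂ) (c : {w : InfinitePlace L // IsComplex w} → Fin 3 → ℝ) :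
    chartOrbG L α ν' S' a' c =
      (letI : MeasurableSpace (↥(arch (↥(maximalRealSubfield L)) L (IsCMField.complexConj L) 3 (Matrix.diagonal α)) ⧸ chartTorusG L α S') := borel _
       haveI : BorelSpace (↥(arch (↥(maximalRealSubfield L)) L (IsCMField.complexConj L) 3 (Matrix.diagonal α)) ⧸ chartTorusG L α S') := ⟨rfl⟩
       ((μ (chartBoxImgG L α S')).toReal : ℂ) *
         ∫ y, descConj (gprimeTorus L α S' c) (chartTorusG L α S') (forall_mem_chartTorusG_comm L α S' c) a' y
           ∂(quotientMeasure (chartTorusG L α S') μ (isClosed_chartTorusG L α S') ν')) := by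
  letI : MeasurableSpace (↥(arch (↥(maximalRealSubfield L)) L (IsCMField.complexConj L) 3 (Matrix.diagonal α)) ⧸ chartTorusG L α S') := borel _
  haveI : BorelSpace (↥(arch (↥(maximalRealSubfield L)) L (IsCMField.complexConj L) 3 (Matrix.diagonal α)) ⧸ chartTorusG L α S') := ⟨rfl⟩
  haveI := isHaarMeasure_chartHaarG L α S'
  haveI := isInvInvariant_chartHaarG L α S'
  rw [chartOrbG_def]
  exact Literature.MeasureTheory.Group.toReal_measure_mul_integral_quotientMeasure_eq_of_isHaarMeasure (chartTorusG L α S') (isClosed_chartTorusG L α S') ν'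
    (chartHaarG L α S') μ (chartBoxImgG L α S') _

variable
  -- orbit-quotient σ-algebras on `G′_∞` (binders; `borel` in the letter's frame)
  [qGP : ∀ γ' : ↥(arch (↥(maximalRealSubfield L)) L (IsCMField.complexConj L) 3 (Matrix.diagonal α)), MeasurableSpace (↥(arch (↥(maximalRealSubfield L)) L (IsCMField.complexConj L) 3 (Matrix.diagonal α)) ⧸ Subgroup.centralizer ({γ'} : Set ↥(arch (↥(maximalRealSubfield L)) L (IsCMField.complexConj L) 3 (Matrix.diagonal α))))]
  [qbGP : ∀ γ' : ↥(arch (↥(maximalRealSubfield L)) L (IsCMField.complexConj L) 3 (Matrix.diagonal α)), BorelSpace (↥(arch (↥(maximalRealSubfield L)) L (IsCMField.complexConj L) 3 (Matrix.diagonal α)) ⧸ Subgroup.centralizer ({γ'} : Set ↥(arch (↥(maximalRealSubfield L)) L (IsCMField.complexConj L) 3 (Matrix.diagonal α))))]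
  (m' : OrbitalMeasureFamily ↥(arch (↥(maximalRealSubfield L)) L (IsCMField.complexConj L) 3 (Matrix.diagonal α)))
  (t' : ∀ γ' : ↥(arch (↥(maximalRealSubfield L)) L (IsCMField.complexConj L) 3 (Matrix.diagonal α)), Measure (Subgroup.centralizer ({γ'} : Set ↥(arch (↥(maximalRealSubfield L)) L (IsCMField.complexConj L) 3 (Matrix.diagonal α)))))
  (hd' : (Matrix.diagonal α).det ≠ 0)
  -- (W′)(C′) of ★ `ArchCompatibleFamiliesG` for the diagonal frame
  (hW' : m'.IsQuotientOf (fun γ => IsRegularElt (γ.val : GL (Fin 3) (mixedEmbedding.mixedSpace L))) ν' t')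
  (hC' : ∀ (γ₁ γ₂ : ↥(arch (↥(maximalRealSubfield L)) L (IsCMField.complexConj L) 3 (Matrix.diagonal α))) (h₁ : IsRegularElt (γ₁.val : GL (Fin 3) (mixedEmbedding.mixedSpace L)))
      (hc : Corresponds (UnitaryGroup.conjMixed (↥(maximalRealSubfield L)) L (IsCMField.complexConj L))
        (UnitaryGroup.archFormOf L 3 (Matrix.diagonal α)) (UnitaryGroup.archFormOf L 3 (Matrix.diagonal α)) γ₁ γ₂),
      Measure.map ⇑(UnitaryGroup.archStableCentralizerEquiv L hd' hd' hc h₁) (t' γ₁) = t' γ₂)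

include hW' hC' in
/-- **THE (CUR-chart) JUNCTION ON `G′`: FRAME READING × FRAME MASS OF THE BOX = CHART READING.**  For a Weil-form frame on `G′_∞ = U(diag α)(L⁺ ⊗ ℝ)` ((W′)+(C′) of ★
`ArchCompatibleFamiliesG`) and a REGULAR chart point `γ′ = gprimeTorus α S′ c` (`c ∈ RegG S′`, `S′ ⊆` split-chart places, `α_i ≠ 0`):
`Φ(⟦γ′⟧, a′; m′) · (t′(γ′) carried to T_{S′})(B′) = chartOrbG ν′ S′ a′ c` — the frame's class orbital integral is the chart functional up to ONE explicit scalar, the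
`t′(γ′)`-mass of the chart box (the frame's free Haar scalar made visible; by ★ p849637 `map_tH_eq_t'_partner` that mass is the `t_H(γ_H)`-mass of the transported box,
the SAME for every partner once the boxes correspond — (PARTNER)).  Road: ★ (D3) `exists_classOrbitalIntegral_mk_eq_integral_descConj_smul_of_atPoint_eq` over the
presentation `T_{S′} = Z(γ′)` (`chartTorusG_eq_centralizer`) + Haar-freeness. [cite: Rogawski1990, §1.7 p. 6; §4.3 (4.3.1) p. 43; §8.2 p. 122] [cite: Shelstad1979, §4 p. 20]
[cite: DeitmarEchterhoff2014, Thm. 1.5.3] -/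
theorem classOrbitalIntegral_mul_measure_box_eq_chartOrbG (hα : ∀ i, α i ≠ 0) (hS' : ∀ w, w ∈ S' → w ∈ splitChartPlaces L α)
    {c : {w : InfinitePlace L // IsComplex w} → Fin 3 → ℝ} (hc : c ∈ ArchCartan.RegG S') (a' : ↥(arch (↥(maximalRealSubfield L)) L (IsCMField.complexConj L) 3 (Matrix.diagonal α)) → ℂ) :
    classOrbitalIntegral m' a' (ConjClasses.mk (gprimeTorus L α S' c)) *
        (((t' (gprimeTorus L α S' c)).map ⇑(MulEquiv.subgroupCongr (chartTorusG_eq_centralizer L α S' hα hS' hc)).symm (chartBoxImgG L α S')).toReal : ℂ) =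
      chartOrbG L α ν' S' a' c := by
  letI : MeasurableSpace (↥(arch (↥(maximalRealSubfield L)) L (IsCMField.complexConj L) 3 (Matrix.diagonal α)) ⧸ chartTorusG L α S') := borel _
  haveI : BorelSpace (↥(arch (↥(maximalRealSubfield L)) L (IsCMField.complexConj L) 3 (Matrix.diagonal α)) ⧸ chartTorusG L α S') := ⟨rfl⟩
  haveI := isHaarMeasure_chartHaarG L α S'
  haveI := isInvInvariant_chartHaarG L α S'
  -- the chart point is regular; (W′)+(C′) read there
  have hreg : IsRegularElt ((gprimeTorus L α S' c).val : GL (Fin 3) (mixedEmbedding.mixedSpace L)) :=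
    (isRegularElt_gprimeTorus_iff_mem_regG L α S' c hS').2 hc
  obtain ⟨i1, i2, hq⟩ := atPoint_eq_quotientMeasure_of_isQuotientOf_of_archCoherent L hd' hW' hC' _ hreg
  haveI := i1
  haveI := i2
  have hout : IsRegularElt ((Quotient.out (ConjClasses.mk (gprimeTorus L α S' c))).val : GL (Fin 3) (mixedEmbedding.mixedSpace L)) := by
    rw [out_conjClassesMk_eq_conj]
    exact isRegularElt_mulAutConj_arch L _ hreg
  haveI := hW'.isAdmissibleOn.smulInvariantMeasure (c := ConjClasses.mk (gprimeTorus L α S' c)) hout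
  -- (D3) over the presentation `T_{S′} = Z(γ′)` against the auxiliary Haar `dt′`
  obtain ⟨κ, hκ, i3, i4, hρ, hI⟩ := (m'.exists_classOrbitalIntegral_mk_eq_integral_descConj_smul_of_atPoint_eq (gprimeTorus L α S' c) hq
    (chartTorusG_eq_centralizer L α S' hα hS' hc) (forall_mem_chartTorusG_comm L α S' c) (isClosed_chartTorusG L α S') (chartHaarG L α S') a')
  haveI := i3
  haveI := i4
  -- `t′(γ′)` carried to `T_{S′}` is `κ • dt′`
  have hmeas : Measurable ⇑(MulEquiv.subgroupCongr (chartTorusG_eq_centralizer L α S' hα hS' hc)) :=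
    (continuous_subtype_val.subtype_mk _ : Continuous ⇑(MulEquiv.subgroupCongr (chartTorusG_eq_centralizer L α S' hα hS' hc))).measurable
  have hmeas' : Measurable ⇑(MulEquiv.subgroupCongr (chartTorusG_eq_centralizer L α S' hα hS' hc)).symm :=
    (continuous_subtype_val.subtype_mk _ : Continuous ⇑(MulEquiv.subgroupCongr (chartTorusG_eq_centralizer L α S' hα hS' hc)).symm).measurable
  have hcarry : (t' (gprimeTorus L α S' c)).map ⇑(MulEquiv.subgroupCongr (chartTorusG_eq_centralizer L α S' hα hS' hc)).symm = κ • chartHaarG L α S' := by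
    rw [hρ, Measure.map_map hmeas' hmeas]
    have hid : (⇑(MulEquiv.subgroupCongr (chartTorusG_eq_centralizer L α S' hα hS' hc)).symm ∘ ⇑(MulEquiv.subgroupCongr (chartTorusG_eq_centralizer L α S' hα hS' hc))) = id :=
      funext fun x => (MulEquiv.subgroupCongr _).symm_apply_apply x
    rw [hid, Measure.map_id]
  -- Haar-freeness against `κ • dt′`, then (D3)
  rw [hcarry, chartOrbG_eq_of_isHaarMeasure L α ν' S' (κ • chartHaarG L α S') a' c, hI, mul_comm]

end Junction

end Literature.NumberTheory.Rogawski1990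

end
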